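import Summits.QuantumFields.YangMills.Theorems.LangevinControlUVOSLegsFromFemtoAndGapDefs
import HarnessLib

/-!
# Crux `NT` (stmt-QuantumFields-19353), stub `stub_cfp : CFP`: the collar clauses of `FC2` / `FC3` with an antitone depth

Helper file (`--supports stmt-QuantumFields-19353`) of the fleet lead prover of crux `NT` (unit `ym-spine-19353-p1`); an
unconditional INTERFACE REDUCTION on the engine side of the registered stub `stub_cfp : CFP` (skeleton v2
«conditional-package», b5b471720c374849: `∃ (r, a)`, units ∧ `FBL ∧ FC2 ∧ FC3`).

The registered conditional two-point / three-point clauses `FC2 G r a`, `FC3 G r a`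
(`Theorems/LangevinControlUVOSLegsFromFemtoAndGapDefs.lean` :150 / :161) carry a scale-indexed collar depth `K(s₀)`
quantified over EVERY physical scale `0 < s₀ ≤ ν · a β` below the pair's separation (`ν = ‖y − x‖`): the bounds must
hold whenever `K(s₀) · ν ≤ depth` for SOME such `s₀`.  That device serves the consumer (`stub_lower` picks the scale);
for the PRODUCER it is an extra universally quantified real.  An engine's collar is antitone in the scale
(`K(s) ≍ g(s)^{-1/2}` grows as `s → 0⁺`), and then the weakest instance is `s₀ = ν · a β` itself.  This file proves the
reduction: if `K` (resp. `K₃`) is antitone on `(0, ∞)` and the bounds hold under the single depth condition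
`K(ν · a β) · ν ≤ depth` (resp. `K₃(n · a β) · n ≤ depth`), then the registered `FC2` (resp. `FC3`) holds with the
same witnesses (`fc2_of_antitoneCollar`, `fc3_of_antitoneCollar`).
-/

set_option autoImplicit false

noncomputable section

open MeasureTheory Filter Topology
open Literature.MathematicalPhysics.QuantumFieldTheory Literature.MathematicalPhysics.QuantumLattice
open Literature.Probability.LatticeModels
open Summit.QuantumFields.YangMills.Cruxes.OSLegsFromFemtoAndGap.DlrCollarTransfer

namespace Summit.QuantumFields.YangMills.Cruxes.NT.ConditionalPackage

variable (G : Type) [Group G] [TopologicalSpace G] [IsTopologicalGroup G] [CompactSpace G]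
  [MeasurableSpace G] [BorelSpace G] (r : LatticeRep G) (a : ℝ → ℝ)

/-- An antitone collar evaluated at the pair's own physical separation is the weakest one: for
`0 < s₀ ≤ s`, `K s · ν ≤ d` implies nothing, but `K s₀ · ν ≤ d` implies `K s · ν ≤ d`. [folklore] -/
theorem collar_le_of_antitone {K : ℝ → ℝ} (hK : AntitoneOn K (Set.Ioi 0)) {s₀ s ν d : ℝ} (hs₀ : 0 < s₀)
    (hle : s₀ ≤ s) (hν : 0 ≤ ν) (h : K s₀ * ν ≤ d) : K s * ν ≤ d :=
  (mul_le_mul_of_nonneg_right (hK (Set.mem_Ioi.2 hs₀) (Set.mem_Ioi.2 (hs₀.trans_le hle)) hle) hν).trans h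

/-- **`FC2` from a single antitone collar condition.**  The registered `FC2 G r a` follows from its variant in which
the collar depth `K` is antitone on `(0, ∞)` and the two-sided conditional two-point bounds are required only under
the ONE depth condition at the pair's own physical separation, `K (‖y − x‖ · a β) · ‖y − x‖ ≤ depth` at `x` and at
`y` (with `0 < ‖y − x‖ · a β`); same witnesses `Γ, β₂, ℓ₂, c₂, C₂, K, n₀`. [folklore] -/
theorem fc2_of_antitoneCollar
    (h : ∃ (Γ : ℝ → ℝ) (β₂ ℓ₂ c₂ C₂ : ℝ) (K : ℝ → ℝ) (n₀ : ℕ), 0 < ℓ₂ ∧ 0 < c₂ ∧ (∀ s, 1 ≤ K s) ∧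
      AntitoneOn K (Set.Ioi 0) ∧ Tendsto (fun s : ℝ => s * K s) (nhdsWithin 0 (Set.Ioi 0)) (nhds 0) ∧ 1 ≤ n₀ ∧
      ContinuousOn Γ (Set.Ioc 0 ℓ₂) ∧ (∀ s : ℝ, 0 < s → s ≤ ℓ₂ → 0 < Γ s ∧ Γ s ≤ 1) ∧
      Tendsto (fun s : ℝ => Γ s / s ^ 8) (nhdsWithin 0 (Set.Ioi 0)) atTop ∧
      ∀ β : ℝ, β₂ ≤ β → ∀ (c : Fin 4 → ℤ) (b : ℕ), (b : ℝ) * a β ≤ ℓ₂ →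
        ∀ (η : LGConfig 4 G) (x y : Fin 4 → ℤ), (n₀ : ℝ) ≤ ‖siteToE (y - x)‖ → 0 < ‖siteToE (y - x)‖ * a β →
          K (‖siteToE (y - x)‖ * a β) * ‖siteToE (y - x)‖ ≤ depth c b x →
          K (‖siteToE (y - x)‖ * a β) * ‖siteToE (y - x)‖ ≤ depth c b y →
          c₂ * Γ (‖siteToE (y - x)‖ * a β) ≤ ‖siteToE (y - x)‖ ^ 8 * kerCov G r β c b η (dens G r x) (dens G r y) ∧
          ‖siteToE (y - x)‖ ^ 8 * kerCov G r β c b η (dens G r x) (dens G r y) ≤ C₂ * Γ (‖siteToE (y - x)‖ * a β)) :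
    FC2 G r a := by
  obtain ⟨Γ, β₂, ℓ₂, c₂, C₂, K, n₀, hℓ₂, hc₂, hK1, hKanti, hKlim, hn₀, hΓc, hΓ, hΓlim, H⟩ := h
  refine ⟨Γ, β₂, ℓ₂, c₂, C₂, K, n₀, hℓ₂, hc₂, hK1, hKlim, hn₀, hΓc, hΓ, hΓlim, ?_⟩
  intro β hβ c b hb η x y s₀ hs₀ hs₀le hn hKx hKy
  have hν : 0 ≤ ‖siteToE (y - x)‖ := norm_nonneg _
  exact H β hβ c b hb η x y hn (hs₀.trans_le hs₀le) (collar_le_of_antitone hKanti hs₀ hs₀le hν hKx)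
    (collar_le_of_antitone hKanti hs₀ hs₀le hν hKy)

/-- **`FC3` from a single antitone collar condition.**  The registered `FC3 G r a` follows from its variant in which
the collar depth `K₃` is antitone on `(0, ∞)` and the signed conditional third-cumulant floor is required only under
the ONE depth condition at the triangle's own physical scale, `K₃ (n · a β) · n ≤ depth` at `x`, `y`, `z` (with
`0 < n · a β`); same witnesses `v, w, σ, δ, Γ₃, β₃, ℓ₃, c₃, K₃, n₃`. [folklore] -/
theorem fc3_of_antitoneCollar
    (h : ∃ (v w : EuclideanSpace ℝ (Fin 4)) (σ δ : ℝ) (Γ₃ : ℝ → ℝ) (β₃ ℓ₃ c₃ : ℝ) (K₃ : ℝ → ℝ) (n₃ : ℕ),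
      (σ = 1 ∨ σ = -1) ∧ 0 < δ ∧ 2 * δ < ‖v‖ ∧ 2 * δ < ‖w‖ ∧ 2 * δ < ‖v - w‖ ∧ 0 < ℓ₃ ∧ 0 < c₃ ∧
      (∀ s, 1 ≤ K₃ s) ∧ AntitoneOn K₃ (Set.Ioi 0) ∧
      Tendsto (fun s : ℝ => s * K₃ s) (nhdsWithin 0 (Set.Ioi 0)) (nhds 0) ∧ 1 ≤ n₃ ∧
      ContinuousOn Γ₃ (Set.Ioc 0 ℓ₃) ∧ (∀ s : ℝ, 0 < s → s ≤ ℓ₃ → 0 < Γ₃ s) ∧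
      Tendsto (fun s : ℝ => Γ₃ s / s ^ 4) (nhdsWithin 0 (Set.Ioi 0)) atTop ∧
      ∀ β : ℝ, β₃ ≤ β → ∀ (c : Fin 4 → ℤ) (b : ℕ), (b : ℝ) * a β ≤ ℓ₃ →
        ∀ (η : LGConfig 4 G) (n : ℕ) (x y z : Fin 4 → ℤ), n₃ ≤ n → 0 < (n : ℝ) * a β →
          ‖siteToE (y - x) - (n : ℝ) • v‖ ≤ δ * n → ‖siteToE (z - x) - (n : ℝ) • w‖ ≤ δ * n →
          K₃ ((n : ℝ) * a β) * n ≤ depth c b x → K₃ ((n : ℝ) * a β) * n ≤ depth c b y →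
          K₃ ((n : ℝ) * a β) * n ≤ depth c b z →
          c₃ * Γ₃ ((n : ℝ) * a β) ≤ σ * (n : ℝ) ^ 12 * kerK3 G r β c b η x y z) :
    FC3 G r a := by
  obtain ⟨v, w, σ, δ, Γ₃, β₃, ℓ₃, c₃, K₃, n₃, hσ, hδ, hv, hw, hvw, hℓ₃, hc₃, hK1, hKanti, hKlim, hn₃, hΓc, hΓ,
    hΓlim, H⟩ := h
  refine ⟨v, w, σ, δ, Γ₃, β₃, ℓ₃, c₃, K₃, n₃, hσ, hδ, hv, hw, hvw, hℓ₃, hc₃, hK1, hKlim, hn₃, hΓc, hΓ, hΓlim, ?_⟩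
  intro β hβ c b hb η n x y z s₀ hs₀ hs₀le hn hy hz hKx hKy hKz
  have hν : 0 ≤ (n : ℝ) := Nat.cast_nonneg n
  exact H β hβ c b hb η n x y z hn (hs₀.trans_le hs₀le) hy hz (collar_le_of_antitone hKanti hs₀ hs₀le hν hKx)
    (collar_le_of_antitone hKanti hs₀ hs₀le hν hKy) (collar_le_of_antitone hKanti hs₀ hs₀le hν hKz)

end Summit.QuantumFields.YangMills.Cruxes.NT.ConditionalPackage

end
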